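import Summits.CriticalPhenomena.PercolationContinuityZ3.Theorems.PercNearOneGluingNoHeavyLowerTailSahiHittingWidthThree
import Summits.CriticalPhenomena.PercolationContinuityZ3.Theorems.PercNearOneGluingNoHeavyLowerTailSahiE4HittingEvents
import HarnessLib

/-!
# `NoHeavyLowerTail` (stmt-CriticalPhenomena-4575) — SAHI POSITIVITY AT EVERY ORDER for hitting families of WIDTH ≤ 4

Support file, seat `prim-l12-p5` (gen 7), `--supports stmt-CriticalPhenomena-4575`, COMPUTATIONAL (it inherits the kernel
certificate `hit4_check` of the hitting `C₄`, `…SahiE4HittingEvents`, p214149).  No definitions, no named facts, no sorries.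

Companion of `…SahiHittingWidthThree` (standard axioms, width ≤ 3): with the hitting `C₄` available for quadruples, Theorem G′
runs with `k = 4`, so FIVE-wise absorption suffices — among any five indices two must carry nested sets.

* `subfamily_four_eq`: a four-element sub-family in increasing enumeration is the literal quadruple (plumbing).
* `sahiE_hit_subfamily_nonneg_of_card_le_four`: sub-families of size ≤ 4 of a hitting family are nonnegative.
* **`prodBernoulli_sahiE_hit_nonneg_of_width_le_four`** (main): hitting families `A : Fin m → Finset ι` in which any five
  indices contain a nested pair (`A i ⊆ A j`) have `0 ≤ E_m(1_{H_{A_0}}, …, 1_{H_{A_{m−1}}})` for every `m`.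
* `prodBernoulli_sahiE_hit_nonneg_of_four_sets`: at most four distinct sets with arbitrary multiplicities — every coefficient
  of Sahi's generating function of four hitting events `H_A, H_B, H_C, H_D` (any finite `A, B, C, D ⊆ ι`) is nonnegative.
* `prodBernoulli_sahiE_someClosed_nonneg_of_width_le_four`: the decreasing form ("some coordinate of `A_k` closed") by reflection.

What remains open for hitting events: `C_m`, `m ≥ 5`, on families containing five pairwise `⊆`-incomparable sets.
-/

namespace Summit.CriticalPhenomena.PercolationContinuityZ3.Theorems

namespace SahiHitting

open Finset Function Literature.Combinatorics.Sahi2008 SahiMomentExpansion SahiHereditaryMeetAbsorption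
open Literature.Probability.Percolation.DecisionTree (ind ind_of_mem ind_of_not_mem ind_nonneg)
open Literature.Probability.LatticeModels (prodBernoulli sahiE3 sahiE4)

variable {α : Type*} [Fintype α]

/-- A four-element sub-family in increasing enumeration is the literal quadruple `![g_{e 0}, g_{e 1}, g_{e 2}, g_{e 3}]`,
`e = S.orderEmbOfFin` (plumbing, as `subfamily_three_eq`). [folklore] -/
theorem subfamily_four_eq (μ : α → ℝ) {N : ℕ} (g : Fin N → α → ℝ) (S : Finset (Fin N)) (hS : S.card = 4) :
    sahiE μ S.card (fun j => g (S.orderEmbOfFin rfl j))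
      = sahiE μ 4 ![g (S.orderEmbOfFin hS 0), g (S.orderEmbOfFin hS 1), g (S.orderEmbOfFin hS 2),
          g (S.orderEmbOfFin hS 3)] := by
  rw [← sahiE_cast μ hS.symm]
  congr 1
  funext j
  have e1 : S.orderEmbOfFin rfl (Fin.cast hS.symm j) = S.orderEmbOfFin hS j :=
    Finset.orderEmbOfFin_eq_orderEmbOfFin_iff.mpr rfl
  rw [e1]
  fin_cases j <;> rfl

variable {ι : Type*} [Fintype ι]

/-- Sub-families of size `≤ 4` of a hitting family are nonnegative: sizes ≤ 3 by `…WidthThree`, size 4 by the hitting `C₄`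
(`prodBernoulli_sahiE4_hit_nonneg`, kernel certificate). [this work] -/
theorem sahiE_hit_subfamily_nonneg_of_card_le_four (p : ι → unitInterval) {m : ℕ} (A : Fin m → Finset ι)
    (S : Finset (Fin m)) (hSne : S.Nonempty) (hS4 : S.card ≤ 4) :
    0 ≤ sahiE (bernoulliWeight p) S.card (fun j => ind {ω : Set ι | ∃ a ∈ A (S.orderEmbOfFin rfl j), a ∈ ω}) := by
  classical
  rcases Nat.lt_or_ge S.card 4 with h | h
  · exact sahiE_hit_subfamily_nonneg_of_card_le_three p A S hSne (by omega)
  · have h4 : S.card = 4 := le_antisymm hS4 h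
    set g : Fin m → Set ι → ℝ := fun l => ind {ω : Set ι | ∃ a ∈ A l, a ∈ ω} with hg
    change 0 ≤ sahiE (bernoulliWeight p) S.card (fun j => g (S.orderEmbOfFin rfl j))
    rw [subfamily_four_eq _ g S h4]
    simp only [hg]
    rw [sahiE_four_ind]
    exact prodBernoulli_sahiE4_hit_nonneg p _ _ _ _

/-- **Sahi positivity at every order for hitting families of width ≤ 4.**  Product Bernoulli weight on `2^ι` (`ι` finite);
if among any five indices two carry nested sets (`A i ⊆ A j`; equal sets count), then
`0 ≤ E_m(1_{H_{A_0}}, …, 1_{H_{A_{m−1}}})` for every `m`.  Inputs: FKG, hitting `C₃`, hitting `C₄` (computational),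
Theorem G′. [this work] -/
theorem prodBernoulli_sahiE_hit_nonneg_of_width_le_four (p : ι → unitInterval) (m : ℕ) (A : Fin m → Finset ι)
    (hw : ∀ S : Finset (Fin m), S.card = 5 → ∃ i ∈ S, ∃ j ∈ S, i ≠ j ∧ A i ⊆ A j) :
    0 ≤ sahiE (bernoulliWeight p) m (fun l => ind {ω : Set ι | ∃ a ∈ A l, a ∈ ω}) :=
  prodBernoulli_sahiE_hit_nonneg_of_nested p (by norm_num : 1 ≤ 4) m A
    (fun S hSne hS4 => sahiE_hit_subfamily_nonneg_of_card_le_four p A S hSne hS4) hw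

/-- **At most four distinct sets, arbitrary multiplicities.**  For finite `B_0, …, B_3 ⊆ ι` and any assignment
`c : Fin m → Fin 4` of slots to sets, `0 ≤ E_m(1_{H_{B_{c 0}}}, …, 1_{H_{B_{c (m−1)}}})` (pigeonhole).  Equivalently: every
coefficient of Sahi's generating function of four hitting events is nonnegative. [this work] -/
theorem prodBernoulli_sahiE_hit_nonneg_of_four_sets (p : ι → unitInterval) (B : Fin 4 → Finset ι) (m : ℕ)
    (c : Fin m → Fin 4) :
    0 ≤ sahiE (bernoulliWeight p) m (fun l => ind {ω : Set ι | ∃ a ∈ B (c l), a ∈ ω}) := by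
  refine prodBernoulli_sahiE_hit_nonneg_of_width_le_four p m (fun l => B (c l)) fun S hS => ?_
  have hlt : (Finset.univ : Finset (Fin 4)).card < S.card := by simp [hS]
  obtain ⟨i, hi, j, hj, hij, hc⟩ := Finset.exists_ne_map_eq_of_card_lt_of_maps_to hlt (f := c) fun _ _ => Finset.mem_univ _
  exact ⟨i, hi, j, hj, hij, by simp [hc]⟩

/-- **Decreasing form, width ≤ 4, every order** (computational): for the events `D_{A_k} = {ω | ∃ a ∈ A_k, a ∉ ω}` ("some
coordinate of `A_k` is closed"), if among any five indices two carry nested sets then `0 ≤ E_m(1_{D_{A_0}}, …, 1_{D_{A_{m−1}}})`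
for every product weight and every `m` — reflection onto the hitting form (`sahiE_someClosed_eq_sahiE_hit`). [this work] -/
theorem prodBernoulli_sahiE_someClosed_nonneg_of_width_le_four (q : ι → unitInterval) (m : ℕ) (A : Fin m → Finset ι)
    (hw : ∀ S : Finset (Fin m), S.card = 5 → ∃ i ∈ S, ∃ j ∈ S, i ≠ j ∧ A i ⊆ A j) :
    0 ≤ sahiE (bernoulliWeight q) m (fun l => ind {ω : Set ι | ∃ a ∈ A l, a ∉ ω}) := by
  rw [sahiE_someClosed_eq_sahiE_hit]
  exact prodBernoulli_sahiE_hit_nonneg_of_width_le_four _ m A hw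

/-- **Locality in width** (the general reduction, recorded with its natural hypothesis): if Sahi positivity holds for ALL
hitting families with at most `k` slots on `2^ι` (`k ≥ 1`) — Sahi's `C_1, …, C_k` for hitting events —, then it holds at EVERY
order for hitting families of width ≤ `k` (among any `k + 1` indices two carry nested sets).  A `k`-slot family has width ≤ `k`,
so the two properties are equivalent; with `k = 4` and the seat's `C₃`, `C₄` this is the main theorem above. [this work] -/
theorem prodBernoulli_sahiE_hit_nonneg_of_width_le (p : ι → unitInterval) {k : ℕ} (hk : 1 ≤ k)
    (hC : ∀ (j : ℕ), j ≤ k → ∀ (B : Fin j → Finset ι),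
      0 ≤ sahiE (bernoulliWeight p) j (fun l => ind {ω : Set ι | ∃ a ∈ B l, a ∈ ω}))
    (m : ℕ) (A : Fin m → Finset ι)
    (hw : ∀ S : Finset (Fin m), S.card = k + 1 → ∃ i ∈ S, ∃ j ∈ S, i ≠ j ∧ A i ⊆ A j) :
    0 ≤ sahiE (bernoulliWeight p) m (fun l => ind {ω : Set ι | ∃ a ∈ A l, a ∈ ω}) :=
  prodBernoulli_sahiE_hit_nonneg_of_nested p hk m A (fun S _ hSk => hC S.card hSk fun j => A (S.orderEmbOfFin rfl j)) hw

end SahiHitting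

end Summit.CriticalPhenomena.PercolationContinuityZ3.Theorems
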